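/-
Copyright (c) 2026. All rights reserved.
Released under Apache 2.0 license as described in the file LICENSE.
Authors: abc-iut cell, seat abc-iut-L4-t9 (gen 4; block W2-B2, model of [AbsTopIII] Cor 3.7 — the
id-rigidity input of Cor 3.7 (v) at the model).
-/
import Literature.AnabelianGeometry.AbsoluteAnabelian.AbsTopIII.MLFGaloisModelRigidity
import Literature.AnabelianGeometry.AbsoluteAnabelian.RigidFunctors
import Literature.AnabelianGeometry.AbsoluteAnabelian.SubpadicSlimProofs
import Literature.AnabelianGeometry.AbsoluteAnabelian.SubpadicExamples
import Literature.AnabelianGeometry.AbsoluteAnabelian.SlimTransport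
import Literature.NumberTheory.GaloisRepresentations.CohomologicalDimension
import Mathlib.CategoryTheory.ObjectProperty.FullSubcategory
import HarnessLib

/-!
# [AbsTopIII] Prop 3.2 (iv) / Cor 3.7 (v) at the MODEL: the model category `𝒳` of MLF-Galois `TF`-pairs
# on `ℚ̄_p` is a groupoid, carries the inner automorphisms, and is ID-RIGID on slim `Π`

S. Mochizuki, *Topics in absolute anabelian geometry III*, J. Math. Sci. Univ. Tokyo 22 (2015)
[MochizukiAbsTopIII2015]; locators = pages of the kurims manuscript (`paper:url-5493eb38cbb7`), read on
the page.  Prop 3.2 (iv) p. 72 l. 16–28: "the natural map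
`Isom_{𝒞^MLF_T}((Π ↷ M_T), (Π* ↷ M*_T)) → Isom_{𝒯𝔾}(Π, Π*)` is injective [...]; if `(Π ↷ M_T)` is of
hyperbolic orbicurve type, then `Aut_{𝒞^MLF_T}((Π ↷ M_T))` is center-free and contains the subgroup
of `Aut_{𝒯𝔾}(Π)` determined by the inner automorphisms of `Π`.  In particular, the categories `𝒯𝔾^hyp`,
`𝒯𝔾^sB`, [double-underlined versions], `𝒞^{MLF-hyp}_T`, `𝒞^{MLF-sB}_T`, [underlined versions] are
id-rigid [cf. §0]"; proof p. 72 l. 45–49: "assertion (iv) follows immediately from assertions (i),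
(ii) [...] together with the slimness of `Π` [cf. [Mzk20], Proposition 2.3, (ii)]".  Cor 3.7 (v)
p. 88 ("`𝒟*` is totally `□`-rigid") is discharged in the tree for every bi-anabelian setting MODULO
the id-rigidity of `𝒳` (abc-iut-L4-t12's `BiAnabelianSetting.cor_3_7_v_of_lift θ (hX : IsIdRigid X)`;
abc-iut-w5-d210's `BiAnabelianSetting.cor_3_7_of_inputs θ hobs hX`), and `𝒳 = 𝒞^{MLF-sB}_{T𝔽}` there
(Cor 3.6 p. 78: `T`-pairs "of strictly Belyi type", Galois-isomorphisms).

PROOF-ONLY companion of `MLFGaloisModelCategories.lean` / `MLFGaloisModelRigidity.lean` (seat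
abc-iut-L4-t9 gen 3: the MODEL category `TFModel p` of model MLF-Galois `TF`-pairs `(Π_k ↷ ℚ̄_p)` and
Galois-isomorphisms, the carrier `𝒳` of the model of the Cor 3.7 input structure).  This file supplies
the residual hypothesis `hX` AT THE MODEL, in the printed generality:

* `TFModel.Hom.inv`, `TFModel.isoOfHom` — every morphism of `𝒳` is invertible (`𝒳` is a groupoid: a
  Galois-isomorphism `(φ_Π, φ_M)` has `φ_M ∈ Gal(ℚ̄_p/ℚ_p)`, gen 3's `TFModel.Hom.galois`);
* `TFModel.innerAut A g` — "the subgroup of `Aut_{𝒯𝔾}(Π)` determined by the inner automorphisms of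
  `Π`" LIFTS to `Aut_𝒳(A)`: `(conj_g, ε_k(g))` is an automorphism of the pair (the model form of
  plan/L4/SUBDAG-AbsTopIII-Prop32.md row P32.iv.L13a-TF, typed abstractly by abc-iut-w4-d045 as
  `GaloisFieldPair.Iso.conj`);
* `TFModel.Hom.eq_id_of_comm_innerAut` — the printed deduction at one object: an endomorphism of
  `A` commuting with all inner automorphisms is the identity, GIVEN that `Π_k` is slim (its Galois
  component `α` satisfies `α(ghg⁻¹) = g α(h) g⁻¹`, so `g⁻¹α(g)` centralises `Π`, hence `α = id` by
  `Z(Π) = 1`; its field component is then an element of `Gal(ℚ̄_p/ℚ_p)` centralising the open subgroup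
  `G_k`, hence trivial by the slimness of `G_{ℚ_p}` — the tree's
  `IsSubpadicFor.isSlimGroup_absoluteGaloisGroup`, [AbsAnab] Thm 1.1.1 (ii) for `ℚ_p`);
* `TFModel.isIdRigid_fullSubcategory_of_slim` — **every full subcategory of `𝒳` all of whose objects
  have slim `Π_k` is id-rigid**; in particular `TFModel.Slim p` (objects with slim `Π_k`) is id-rigid
  (`TFModel.isIdRigid_slim`).  Print's `𝒞^{MLF-sB} ⊆ 𝒞^{MLF-hyp}` are such subcategories: `Π` of
  hyperbolic orbicurve type is slim ([AbsTopI] Prop 2.3 (ii)) — slimness is carried as the object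
  property, exactly the input named in abc-iut-w4-d045's `prop32iv_idRigidTF_of_isSlimGroup` (which
  is the same statement over abc-iut-L4-t2's ABSTRACT category of `TF`-pairs; not restated here).

Remark (documentation only, no claim is typed): for the UNRESTRICTED model category `TFModel p`
(arbitrary topological groups `Π_k` with a continuous surjection onto `G_k`, e.g. `Π_k = G_k × ℤ`)
id-rigidity is not to be expected — this is why print states (v) on `𝒞^{MLF-sB}`.  HONEST FRAMING:
refereed pre-IUT material; classical Galois theory of `ℚ_p`; nothing here bears on [IUTchIII] Cor. 3.12;
typed ≠ discharged except for the theorems of this file.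
-/

set_option autoImplicit false

noncomputable section

namespace Literature.AnabelianGeometry.AbsoluteAnabelian.AbsTopIII

open CategoryTheory
open Literature.AlgebraicGeometry.Frobenioids (IsSlimGroup)

variable {p : ℕ} [hp : Fact p.Prime]

namespace TFModel

variable {A B : TFModel p}

/-! ## `𝒳` is a groupoid: inverses of Galois-isomorphisms -/

namespace Hom

/-- `φ_Π (φ_Π⁻¹ g) = g`. [cite: MochizukiAbsTopIII2015, Definition 3.1 (ii) p.67] -/
@[simp] theorem homPi_piIso_symm_apply (f : Hom A B) (g : B.pair.Pi) :
    f.hom.homPi (f.piIso.symm g) = g := by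
  rw [← Hom.piIso_apply, ContinuousMulEquiv.apply_symm_apply]

/-- `φ_M (σ_φ⁻¹ x) = x`. [cite: MochizukiAbsTopIII2015, Definition 3.1 (ii) p.67] -/
@[simp] theorem homM_galois_symm_apply (f : Hom A B) (x : PadicAlgCl p) :
    f.hom.homM (f.galois.symm x) = x := by
  rw [← Hom.galois_apply, AlgEquiv.apply_symm_apply]

/-- **The inverse of a Galois-isomorphism of model `TF`-pairs** `(φ_Π, φ_M) : A → B`: the pair
`(φ_Π⁻¹, σ_φ⁻¹)` (with `σ_φ = φ_M ∈ Gal(ℚ̄_p/ℚ_p)`), again a morphism of MLF-Galois `TF`-pairs in the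
sense of Def 3.1 (ii) ("a compatible continuous homomorphism [...] that induces an open injective
homomorphism between the respective arithmetic Galois groups") and again a Galois-isomorphism.
[cite: MochizukiAbsTopIII2015, Definition 3.1 (ii) p.67] -/
def inv (f : Hom A B) : Hom B A where
  hom :=
    { homPi := f.piIso.symm.toMonoidHom
      continuous_homPi := f.piIso.symm.continuous
      homM := (f.galois.symm : PadicAlgCl p ≃ₐ[ℚ_[p]] PadicAlgCl p).toRingEquiv.toRingHom
      smul_comm := fun g x => by
        apply f.galois.injective
        rw [B.smul_eq_augQ, A.smul_eq_augQ]
        change f.galois (f.galois.symm (B.augQ g x)) =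
          f.hom.homM (A.augQ (f.piIso.symm g) (f.galois.symm x))
        rw [AlgEquiv.apply_symm_apply, ← f.augQ_homPi_apply, homPi_piIso_symm_apply,
          homM_galois_symm_apply]
      comap_ker := by
        have h := f.hom.comap_ker
        apply_fun Subgroup.comap f.piIso.symm.toMonoidHom at h
        rw [Subgroup.comap_comap] at h
        have hid : f.hom.homPi.comp f.piIso.symm.toMonoidHom = MonoidHom.id _ :=
          MonoidHom.ext fun g => f.homPi_piIso_symm_apply g
        rw [hid, Subgroup.comap_id] at h
        exact h.symm
      isOpen_image := fun U hU => by
        have hmap : U.map f.piIso.symm.toMonoidHom = U.comap f.hom.homPi := by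
          ext g
          simp only [Subgroup.mem_map, Subgroup.mem_comap]
          constructor
          · rintro ⟨u, hu, rfl⟩
            change f.hom.homPi (f.piIso.symm u) ∈ U
            rwa [homPi_piIso_symm_apply]
          · intro hg
            refine ⟨f.hom.homPi g, hg, ?_⟩
            change f.piIso.symm (f.piIso g) = g
            exact f.piIso.symm_apply_apply g
        rw [hmap]
        exact Subgroup.isOpen_mono le_sup_left (hU.preimage f.hom.continuous_homPi) }
  bijective := f.piIso.symm.bijective
  isOpenMap := f.piIso.symm.isOpenMap

/-- `φ_Π` of the inverse is `φ_Π⁻¹`. [cite: MochizukiAbsTopIII2015, Definition 3.1 (ii) p.67] -/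
@[simp] theorem inv_homPi_apply (f : Hom A B) (g : B.pair.Pi) : f.inv.hom.homPi g = f.piIso.symm g := rfl

/-- `φ_M` of the inverse is `σ_φ⁻¹`. [cite: MochizukiAbsTopIII2015, Definition 3.1 (ii) p.67] -/
@[simp] theorem inv_homM_apply (f : Hom A B) (x : PadicAlgCl p) :
    f.inv.hom.homM x = f.galois.symm x := rfl

end Hom

/-- **`𝒳` is a groupoid**: every morphism of the model category (a Galois-isomorphism of model
MLF-Galois `TF`-pairs) is an isomorphism, with inverse `Hom.inv`.
[cite: MochizukiAbsTopIII2015, Definition 3.1 (iii) p.68] -/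
def isoOfHom (f : A ⟶ B) : A ≅ B where
  hom := f
  inv := (f : Hom A B).inv
  hom_inv_id := by
    apply Hom.ext; apply GaloisFieldPair.Hom.ext
    · ext g
      change (f : Hom A B).piIso.symm ((f : Hom A B).hom.homPi g) = g
      rw [← Hom.piIso_apply, ContinuousMulEquiv.symm_apply_apply]
    · ext x
      change (f : Hom A B).galois.symm ((f : Hom A B).hom.homM x) = x
      rw [← Hom.galois_apply, AlgEquiv.symm_apply_apply]
  inv_hom_id := by
    apply Hom.ext; apply GaloisFieldPair.Hom.ext
    · ext g
      exact (f : Hom A B).homPi_piIso_symm_apply g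
    · ext x
      exact (f : Hom A B).homM_galois_symm_apply x

/-- Hence every morphism of `𝒳` is an isomorphism in Mathlib's sense (a theorem, not an instance).
[cite: MochizukiAbsTopIII2015, Definition 3.1 (iii) p.68] -/
theorem isIso_of_hom (f : A ⟶ B) : IsIso f := (isoOfHom f).isIso_hom

/-! ## Inner automorphisms lift to `Aut_𝒳(A)` -/

/-- Conjugation by `g` maps the (normal) kernel of the Galois augmentation onto itself, in the
`comap` form used by Def 3.1 (ii) morphisms. [cite: MochizukiAbsTopIII2015, Proposition 3.2 (iv) p.72] -/
theorem comap_conj_actionKer (A : TFModel p) (g : A.pair.Pi) :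
    A.pair.actionKer.comap (MulAut.conj g).toMonoidHom = A.pair.actionKer := by
  ext h
  rw [Subgroup.mem_comap]
  change g * h * g⁻¹ ∈ A.pair.actionKer ↔ h ∈ A.pair.actionKer
  have hn : A.pair.actionKer.Normal := by unfold GaloisFieldPair.actionKer; infer_instance
  constructor
  · intro hm
    have key : g⁻¹ * (g * h * g⁻¹) * g⁻¹⁻¹ = h := by group
    have := hn.conj_mem _ hm g⁻¹
    rwa [key] at this
  · intro hm
    exact hn.conj_mem _ hm g

/-- `ε_k(g⁻¹) (ε_k(g) x) = x`. [cite: MochizukiAbsTopIII2015, Definition 3.1 (i) p.66] -/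
@[simp] theorem augQ_inv_apply_augQ (A : TFModel p) (g : A.pair.Pi) (x : PadicAlgCl p) :
    A.augQ g⁻¹ (A.augQ g x) = x := by
  rw [← AlgEquiv.mul_apply, ← A.augQ_mul, inv_mul_cancel, A.augQ_one, AlgEquiv.one_apply]

/-- **Prop 3.2 (iv): inner automorphisms of `Π` lift to automorphisms of the pair** — for
`g ∈ Π_k`, `(conj_g, ε_k(g)) : (Π_k ↷ ℚ̄_p) → (Π_k ↷ ℚ̄_p)` is a morphism of MLF-Galois `TF`-pairs
(compatibility: `ε(g)(ε(h) x) = ε(ghg⁻¹)(ε(g) x)`) and a Galois-isomorphism; "[`Aut_{𝒞^MLF_T}((Π ↷ M_T))`]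
contains the subgroup of `Aut_{𝒯𝔾}(Π)` determined by the inner automorphisms of `Π`".
[cite: MochizukiAbsTopIII2015, Proposition 3.2 (iv) p.72] -/
def innerAut (A : TFModel p) (g : A.pair.Pi) : A ⟶ A :=
  { hom :=
      { homPi := (MulAut.conj g).toMonoidHom
        continuous_homPi := by
          change Continuous fun h => g * h * g⁻¹
          exact (continuous_const.mul continuous_id).mul continuous_const
        homM := (A.augQ g : PadicAlgCl p ≃ₐ[ℚ_[p]] PadicAlgCl p).toRingEquiv.toRingHom
        smul_comm := fun h x => by
          rw [A.smul_eq_augQ, A.smul_eq_augQ]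
          change A.augQ g (A.augQ h x) = A.augQ (g * h * g⁻¹) (A.augQ g x)
          rw [A.augQ_mul, A.augQ_mul, AlgEquiv.mul_apply, AlgEquiv.mul_apply,
            augQ_inv_apply_augQ]
        comap_ker := A.comap_conj_actionKer g
        isOpen_image := fun U hU => by
          have hmap : (U.map (MulAut.conj g).toMonoidHom : Set A.pair.Pi) =
              (Homeomorph.mulLeft g |>.trans (Homeomorph.mulRight g⁻¹)) '' (U : Set A.pair.Pi) := by
            ext h
            simp only [Subgroup.coe_map, Set.mem_image, SetLike.mem_coe, Homeomorph.trans_apply,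
              Homeomorph.coe_mulLeft, Homeomorph.coe_mulRight]
            rfl
          have hopen : IsOpen (U.map (MulAut.conj g).toMonoidHom : Set A.pair.Pi) := by
            rw [hmap]; exact (Homeomorph.isOpenMap _) _ hU
          exact Subgroup.isOpen_mono le_sup_left hopen }
    bijective := (MulAut.conj g).bijective
    isOpenMap := by
      change IsOpenMap fun h => g * h * g⁻¹
      exact (Homeomorph.mulLeft g |>.trans (Homeomorph.mulRight g⁻¹)).isOpenMap }

/-- `φ_Π` of the inner automorphism is conjugation by `g`.
[cite: MochizukiAbsTopIII2015, Proposition 3.2 (iv) p.72] -/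
@[simp] theorem innerAut_homPi_apply (A : TFModel p) (g h : A.pair.Pi) :
    (A.innerAut g : Hom A A).hom.homPi h = g * h * g⁻¹ := rfl

/-- `φ_M` of the inner automorphism is `ε_k(g)`.
[cite: MochizukiAbsTopIII2015, Proposition 3.2 (iv) p.72] -/
@[simp] theorem innerAut_homM_apply (A : TFModel p) (g : A.pair.Pi) (x : PadicAlgCl p) :
    (A.innerAut g : Hom A A).hom.homM x = A.augQ g x := rfl

/-! ## The range of the Galois augmentation in `Gal(ℚ̄_p/ℚ_p)` is open -/

/-- `ε_k` followed by `G_k ⊆ G_{ℚ_p}`, as a group homomorphism `Π_k → Gal(ℚ̄_p/ℚ_p)`.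
[cite: MochizukiAbsTopIII2015, Definition 3.1 (i) p.66] -/
def augQHom (A : TFModel p) : A.pair.Pi →* (PadicAlgCl p ≃ₐ[ℚ_[p]] PadicAlgCl p) where
  toFun := A.augQ
  map_one' := A.augQ_one
  map_mul' := A.augQ_mul

/-- `augQHom` is `augQ`. [cite: MochizukiAbsTopIII2015, Definition 3.1 (i) p.66] -/
@[simp] theorem augQHom_apply (A : TFModel p) (g : A.pair.Pi) : A.augQHom g = A.augQ g := rfl

/-- The image of `Π_k ↠ G_k ⊆ G_{ℚ_p}` contains `G_k = Gal(ℚ̄_p/k)` (the fixing subgroup of `k`): an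
automorphism fixing `k` is `k`-linear, hence of the form `ε_k(g)` (`ε_k` is surjective).
[cite: MochizukiAbsTopIII2015, Definition 3.1 (i) p.66] -/
theorem fixingSubgroup_le_range_augQHom (A : TFModel p) :
    A.k.fixingSubgroup ≤ A.augQHom.range := by
  intro τ hτ
  obtain ⟨g, hg⟩ := A.D.aug_surjective (IntermediateField.fixingSubgroupEquiv A.k ⟨τ, hτ⟩)
  refine ⟨g, ?_⟩
  ext x
  rw [augQHom_apply, augQ_apply, hg]
  rfl

/-- Hence the image of `Π_k` in `G_{ℚ_p}` contains an OPEN subgroup (`G_k` is open: `k/ℚ_p` is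
finite, Krull topology). [cite: MochizukiAbsTopIII2015, Definition 3.1 (i) p.66] -/
theorem isOpen_fixingSubgroup_k (A : TFModel p) :
    IsOpen (A.k.fixingSubgroup : Set (PadicAlgCl p ≃ₐ[ℚ_[p]] PadicAlgCl p)) :=
  IntermediateField.fixingSubgroup_isOpen A.k

/-! ## The printed deduction: commuting with all inner automorphisms forces the identity -/

/-- `G_{ℚ_p} = Gal(ℚ̄_p/ℚ_p)` is slim ([AbsAnab] Thm 1.1.1 (ii); in the tree for every sub-`p`-adic
field, `IsSubpadicFor.isSlimGroup_absoluteGaloisGroup`, here `ℚ_p` itself).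
[cite: MochizukiAbsTopIII2015, Proposition 3.2 (iv) p.72] -/
theorem isSlimGroup_galQp : IsSlimGroup (PadicAlgCl p ≃ₐ[ℚ_[p]] PadicAlgCl p) :=
  Literature.AnabelianGeometry.AbsoluteAnabelian.IsSubpadicFor.isSlimGroup_absoluteGaloisGroup
    (IsSubpadicFor.padic p)

/-- `G_k = Gal(ℚ̄_p/k)` is slim for the base `k` of every model object (`k/ℚ_p` finite, hence
sub-`p`-adic; `ℚ̄_p` is an algebraic closure of `k`, and slimness is transported from Mathlib's
`Field.absoluteGaloisGroup k` along the tree's `algEquivContinuousMulEquivAbsoluteGaloisGroup`).  So the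
MONO-ANALYTIC model objects `(G_k ↷ ℚ̄_p)` (Def 3.1 (ii)) have slim `Π_k`.
[cite: MochizukiAbsTopIII2015, Proposition 3.2 (iv) p.72] -/
theorem isSlimGroup_galk (A : TFModel p) : IsSlimGroup (PadicAlgCl p ≃ₐ[A.k] PadicAlgCl p) := by
  haveI : IsAlgClosure A.k (PadicAlgCl p) :=
    { isAlgClosed := inferInstance, isAlgebraic := A.isAlgebraic }
  have hk : IsSubpadicFor A.k p := (IsSubpadicFor.padic p).of_finite
  exact isSlimGroup_of_continuousMulEquiv
    (Literature.NumberTheory.GaloisRepresentations.algEquivContinuousMulEquivAbsoluteGaloisGroup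
      A.k (PadicAlgCl p)).symm
    (Literature.AnabelianGeometry.AbsoluteAnabelian.IsSubpadicFor.isSlimGroup_absoluteGaloisGroup hk)

namespace Hom

/-- **Step 1 (Galois component).**  If an endomorphism `a = (α, σ)` of `A` commutes with every inner
automorphism and `Π_k` is slim, then `α = id`: from `α(ghg⁻¹) = g α(h) g⁻¹` and
`α(ghg⁻¹) = α(g)α(h)α(g)⁻¹` the element `g⁻¹α(g)` centralises `α(Π) = Π`, so it is trivial.
[cite: MochizukiAbsTopIII2015, Proposition 3.2 (iv) p.72] -/
theorem homPi_eq_self_of_comm_innerAut (a : Hom A A) (hslim : IsSlimGroup A.pair.Pi)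
    (hcomm : ∀ g : A.pair.Pi, A.innerAut g ≫ (show A ⟶ A from a) = (show A ⟶ A from a) ≫ A.innerAut g)
    (g : A.pair.Pi) : a.hom.homPi g = g := by
  -- the conjugation relation `α (g h g⁻¹) = g α(h) g⁻¹`
  have hconj : ∀ g h : A.pair.Pi, a.hom.homPi (g * h * g⁻¹) = g * a.hom.homPi h * g⁻¹ := fun g h => by
    have e := congrArg (fun f : A ⟶ A => (f : Hom A A).hom.homPi h) (hcomm g)
    simp only [TFModel.comp_homPi_apply, innerAut_homPi_apply] at e
    exact e
  -- `g⁻¹ α(g)` is central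
  have hz : ∀ h : A.pair.Pi, h * (g⁻¹ * a.hom.homPi g) = (g⁻¹ * a.hom.homPi g) * h := by
    intro h
    obtain ⟨h', rfl⟩ := a.bijective.2 h
    have e := hconj g h'
    rw [map_mul, map_mul, map_inv] at e
    -- `α g * α h' * (α g)⁻¹ = g * α h' * g⁻¹`
    calc a.hom.homPi h' * (g⁻¹ * a.hom.homPi g)
        = g⁻¹ * (g * a.hom.homPi h' * g⁻¹) * a.hom.homPi g := by group
      _ = g⁻¹ * (a.hom.homPi g * a.hom.homPi h' * (a.hom.homPi g)⁻¹) * a.hom.homPi g := by rw [e]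
      _ = g⁻¹ * a.hom.homPi g * a.hom.homPi h' := by group
  -- in the slim group `Π` the centre is trivial (the whole group is an open subgroup; cf. the
  -- tree's `EtaleTheta.ThetaSetting.eq_one_of_central_of_slim`, not imported here)
  have h1 : g⁻¹ * a.hom.homPi g = 1 := by
    have hmem : g⁻¹ * a.hom.homPi g ∈ Subgroup.centralizer ((⊤ : Subgroup A.pair.Pi) : Set A.pair.Pi) :=
      Subgroup.mem_centralizer_iff.mpr fun h _ => hz h
    rw [hslim.centralizer_eq_bot ⊤ (by rw [Subgroup.coe_top]; exact isOpen_univ)] at hmem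
    exact (Subgroup.mem_bot).mp hmem
  calc a.hom.homPi g = g * (g⁻¹ * a.hom.homPi g) := by group
    _ = g := by rw [h1, mul_one]

/-- **Step 2 (field component).**  If the Galois component of an endomorphism `a = (α, σ_a)` of `A`
is the identity, then `σ_a ∈ Gal(ℚ̄_p/ℚ_p)` commutes with `ε_k(Π_k) ⊇ G_k`, an open subgroup of the
slim group `G_{ℚ_p}`; hence `σ_a = 1`. [cite: MochizukiAbsTopIII2015, Proposition 3.2 (iv) p.72] -/
theorem galois_eq_refl_of_homPi_eq_self (a : Hom A A) (hPi : ∀ g : A.pair.Pi, a.hom.homPi g = g) :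
    a.galois = AlgEquiv.refl := by
  -- `σ_a` commutes with every `ε_k(g)`
  have hc : ∀ g : A.pair.Pi, A.augQ g * a.galois = a.galois * A.augQ g := fun g => by
    ext x
    rw [AlgEquiv.mul_apply, AlgEquiv.mul_apply, Hom.galois_apply, Hom.galois_apply]
    have e := a.hom.smul_comm g x
    rw [hPi, A.smul_eq_augQ, A.smul_eq_augQ] at e
    exact e.symm
  -- hence it centralises the open subgroup `G_k`
  have hmem : a.galois ∈ Subgroup.centralizer
      (A.k.fixingSubgroup : Set (PadicAlgCl p ≃ₐ[ℚ_[p]] PadicAlgCl p)) := by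
    refine Subgroup.mem_centralizer_iff.mpr fun τ hτ => ?_
    obtain ⟨g, rfl⟩ := A.fixingSubgroup_le_range_augQHom hτ
    exact hc g
  rw [isSlimGroup_galQp.centralizer_eq_bot _ A.isOpen_fixingSubgroup_k] at hmem
  exact (Subgroup.mem_bot).mp hmem

/-- **Prop 3.2 (iv) at one object of the model**: an endomorphism of `A = (Π_k ↷ ℚ̄_p)` in `𝒳` that
commutes with all inner automorphisms is the identity, provided `Π_k` is slim ("together with the
slimness of `Π`", proof p. 72).  This is the objectwise content of "`𝒞^{MLF-sB}_T` is id-rigid".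
[cite: MochizukiAbsTopIII2015, Proposition 3.2 (iv) p.72] -/
theorem eq_id_of_comm_innerAut (a : A ⟶ A) (hslim : IsSlimGroup A.pair.Pi)
    (hcomm : ∀ g : A.pair.Pi, A.innerAut g ≫ a = a ≫ A.innerAut g) : a = 𝟙 A := by
  have hPi := (a : Hom A A).homPi_eq_self_of_comm_innerAut hslim hcomm
  have hσ := (a : Hom A A).galois_eq_refl_of_homPi_eq_self hPi
  apply Hom.ext; apply GaloisFieldPair.Hom.ext
  · exact MonoidHom.ext hPi
  · ext x
    change (a : Hom A A).hom.homM x = x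
    rw [← Hom.galois_apply, hσ, AlgEquiv.coe_refl, id]

end Hom

/-! ## Id-rigidity of `𝒞^{MLF-sB}`-type full subcategories of the model -/

/-- **[AbsTopIII] Prop 3.2 (iv), last sentence, AT THE MODEL: every full subcategory of `𝒳` all of
whose objects have slim `Π_k` is id-rigid.**  An automorphism `η` of the identity functor has, at each
object, a component commuting (naturality) with the inner automorphisms — which lie in the full
subcategory — so each component is the identity by `Hom.eq_id_of_comm_innerAut`.  Print's
`𝒞^{MLF-sB}_{T𝔽} ⊆ 𝒞^{MLF-hyp}_{T𝔽}` are such subcategories ([AbsTopI] Prop 2.3 (ii): `Π` of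
hyperbolic orbicurve type is slim).  This is the hypothesis `hX : IsIdRigid X` of Cor 3.7 (v)
(`BiAnabelianSetting.cor_3_7_v_of_lift`) for the model restricted as printed.
[cite: MochizukiAbsTopIII2015, Proposition 3.2 (iv) p.72] -/
theorem isIdRigid_fullSubcategory_of_slim (P : ObjectProperty (TFModel p))
    (hP : ∀ A : TFModel p, P A → IsSlimGroup A.pair.Pi) : IsIdRigid P.FullSubcategory := by
  refine isRigidFunctor_of_hom_app_eq_id fun η X => ?_
  apply P.hom_ext
  change (η.hom.app X).hom = 𝟙 X.obj
  refine Hom.eq_id_of_comm_innerAut _ (hP X.obj X.property) fun g => ?_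
  have e := η.hom.naturality (ObjectProperty.homMk (X.obj.innerAut g) : X ⟶ X)
  exact congrArg InducedCategory.Hom.hom e

variable (p) in
/-- The full subcategory `𝒳^slim ⊆ 𝒳` of model `TF`-pairs `(Π_k ↷ ℚ̄_p)` with SLIM `Π_k` — the model
home of print's `𝒞^{MLF-sB}_{T𝔽} ⊆ 𝒞^{MLF-hyp}_{T𝔽}` as far as id-rigidity is concerned (the
scheme-theoretic conditions "of hyperbolic orbicurve / strictly Belyi type" imply slimness of `Π`,
[AbsTopI] Prop 2.3 (ii), and are not imposed here). [cite: MochizukiAbsTopIII2015, Definition 3.1 (iii) p.68] -/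
abbrev Slim : Type 1 :=
  ObjectProperty.FullSubcategory (fun A : TFModel p => IsSlimGroup A.pair.Pi)

variable (p) in
/-- **`𝒳^slim` is id-rigid** (Prop 3.2 (iv) at the model; the `hX` of Cor 3.7 (v)).
[cite: MochizukiAbsTopIII2015, Proposition 3.2 (iv) p.72] -/
theorem isIdRigid_slim : IsIdRigid (Slim p) :=
  isIdRigid_fullSubcategory_of_slim _ fun _ h => h

end TFModel

end Literature.AnabelianGeometry.AbsoluteAnabelian.AbsTopIII

end
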